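import Summits.AnomalousDissipation.AnomalousDissipation.Theorems.MomentParityPathFunctionals
import Literature.Analysis.FunctionSpaces.TorusSpaceTimeFields
import Literature.Analysis.FunctionSpaces.TorusVectorParseval
import Literature.Analysis.FunctionSpaces.TorusSpectralWeakDerivative
import Mathlib.MeasureTheory.Integral.MeanInequalities

/-!
# Route MomentParity · `GalerkinEnsembleRealization` — the velocity field of a path of `𝒦`

For a path `ω` of the trajectory space `pathSpace R L` (`MomentParityDefs`) and a time shift
`s ≥ 0` there is a measurable family of real `L²` fields `u t`, `t ≥ 0`, on `T^d` with Fourier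
coefficients `𝓕(u t)(k) = ω̄(s + t, k)` (Riesz–Fischer with parameter,
`exists_realField_forall_mFourierCoeff_eq`).  By Parseval, for such a field
`∫ ‖u t‖² = pathEnergyTot ω (s + t)`, `|∫ ⟪g, u t⟫| ≤ ‖g‖₂ · (pathEnergyTot ω (s + t))^{1/2}`, and
the resolved dissipation `pathDiss ν K ω (s + t)` is at most `ν ‖∇(u t)‖₂²` whenever the latter
is finite; the enstrophy `t ↦ ‖∇(u t)‖₂²` is measurable on `t > 0`
(stmt-AnomalousDissipation-11466, realisation step).
-/

noncomputable section

set_option linter.dupNamespace false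

open MeasureTheory Set Filter Topology Function UnitAddTorus
open scoped BigOperators ENNReal InnerProductSpace RealInnerProductSpace

namespace Summit.AnomalousDissipation.AnomalousDissipation.Theorems.MomentParity

open Literature.Analysis.FunctionSpaces Literature.Analysis.FunctionSpaces.Torus Literature.Analysis.FluidPDE

variable {d : Type*} [Fintype d] {R : ℝ} {L : (d → ℤ) → ℝ}

/-! ### The spectral energy of a path in `ℝ≥0∞` -/

/-- `‖v‖ₑ² = ofReal ‖v‖²`. -/
theorem enorm_sq_eq_ofReal_norm_sq {F : Type*} [NormedAddCommGroup F] (v : F) :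
    ‖v‖ₑ ^ 2 = ENNReal.ofReal (‖v‖ ^ 2) := by
  rw [← ofReal_norm, ENNReal.ofReal_pow (norm_nonneg _)]

/-- The total spectral energy of a path of `𝒦` in `ℝ≥0∞`: `∑' ‖ω̄(t,k)‖ₑ² ≤ R²`. -/
theorem tsum_enorm_pathExt_sq_le {ω : Path d} (hω : ω ∈ pathSpace R L) (t : ℝ) :
    ∑' k, ‖pathExt ω t k‖ₑ ^ 2 ≤ ENNReal.ofReal (R ^ 2) := by
  have hs := summable_norm_pathExt_sq hω t
  calc ∑' k, ‖pathExt ω t k‖ₑ ^ 2 = ∑' k, ENNReal.ofReal (‖pathExt ω t k‖ ^ 2) :=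
        tsum_congr fun k => enorm_sq_eq_ofReal_norm_sq _
    _ = ENNReal.ofReal (∑' k, ‖pathExt ω t k‖ ^ 2) :=
        (ENNReal.ofReal_tsum_of_nonneg (fun _ => sq_nonneg _) hs).symm
    _ ≤ ENNReal.ofReal (R ^ 2) := ENNReal.ofReal_le_ofReal (pathEnergyTot_le hω t)

/-! ### The field of a path -/

/-- **The velocity field of a path.**  For `ω ∈ 𝒦` and `s ≥ 0` there is a space–time measurable
family of real `L²` fields `u t` (`t ≥ 0`) with `𝓕(u t)(k) = ω̄(s + t, k)` for every `k`. -/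
theorem exists_pathField {ω : Path d} (hω : ω ∈ pathSpace R L) (s : ℝ) :
    ∃ u : ℝ → UnitAddTorus d → EuclideanSpace ℝ d,
      AEStronglyMeasurable (stLift u) (volume.restrict (Ioi 0 ×ˢ univ)) ∧
      ∀ t, 0 ≤ t → MemLp (u t) 2 volume ∧
        ∀ k, mFourierCoeff (EuclideanSpace.complexify ∘ u t) k = pathExt ω (s + t) k := by
  refine exists_realField_forall_mFourierCoeff_eq (c := fun t k => pathExt ω (s + t) k)
    (fun k => ?_) (fun T => ⟨_, ENNReal.ofReal_ne_top, fun t _ => tsum_enorm_pathExt_sq_le hω (s + t)⟩)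
    (fun t _ => isConjSymm_pathExt hω (s + t))
  exact ((continuous_pathExt_time hω k).comp (continuous_const.add continuous_id)).aestronglyMeasurable

/-! ### Parseval consequences for a field with the coefficients of a path -/

/-- **Energy**: `∫ ‖v‖² = pathEnergyTot ω t` when `𝓕 v = ω̄(t, ·)` and `v ∈ L²`. -/
theorem integral_norm_sq_eq_pathEnergyTot {ω : Path d} {t : ℝ}
    {v : UnitAddTorus d → EuclideanSpace ℝ d} (hv : MemLp v 2 volume)
    (hcoef : ∀ k, mFourierCoeff (EuclideanSpace.complexify ∘ v) k = pathExt ω t k) :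
    ∫ x, ‖v x‖ ^ 2 = pathEnergyTot ω t := by
  rw [integral_norm_sq_eq_tsum hv, pathEnergyTot]
  exact tsum_congr fun k => by rw [hcoef k]

/-- **Cauchy–Schwarz for pairings of `L²` fields on `T^d`**:
`|∫ ⟪g, v⟫| ≤ (∫ ‖g‖²)^{1/2} (∫ ‖v‖²)^{1/2}` (Hölder with `p = q = 2`; the same statement as
`Torus.abs_integral_inner_le_sqrt_sq_mul_sqrt_sq`, reproved here to keep the imports light). -/
theorem abs_integral_inner_le_sqrt_mul_sqrt {g v : UnitAddTorus d → EuclideanSpace ℝ d}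
    (hg : MemLp g 2 volume) (hv : MemLp v 2 volume) :
    |∫ x, ⟪g x, v x⟫_ℝ| ≤ Real.sqrt (∫ x, ‖g x‖ ^ 2) * Real.sqrt (∫ x, ‖v x‖ ^ 2) := by
  have hint : Integrable (fun x => ‖g x‖ * ‖v x‖) volume := hg.norm.integrable_mul hv.norm
  have h := integral_mul_norm_le_Lp_mul_Lq (μ := volume) (f := fun x => ‖g x‖) (g := fun x => ‖v x‖)
    Real.HolderConjugate.two_two (by simpa using hg.norm) (by simpa using hv.norm)
  simp only [norm_norm, Real.rpow_two, one_div, Real.sqrt_eq_rpow] at h ⊢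
  calc |∫ x, ⟪g x, v x⟫_ℝ| ≤ ∫ x, |⟪g x, v x⟫_ℝ| := abs_integral_le_integral_abs
    _ ≤ ∫ x, ‖g x‖ * ‖v x‖ := integral_mono_of_nonneg (ae_of_all _ fun x => abs_nonneg _) hint
        (ae_of_all _ fun x => abs_real_inner_le_norm (g x) (v x))
    _ ≤ _ := h

/-- **Pairing with a fixed field**: `|∫ ⟪g, v⟫| ≤ (∫ ‖g‖²)^{1/2} (pathEnergyTot ω t)^{1/2}`. -/
theorem abs_integral_inner_le_of_coef {ω : Path d} {t : ℝ}
    {v : UnitAddTorus d → EuclideanSpace ℝ d} (hv : MemLp v 2 volume)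
    (hcoef : ∀ k, mFourierCoeff (EuclideanSpace.complexify ∘ v) k = pathExt ω t k)
    {g : UnitAddTorus d → EuclideanSpace ℝ d} (hg : MemLp g 2 volume) :
    |∫ x, ⟪g x, v x⟫_ℝ| ≤ Real.sqrt (∫ x, ‖g x‖ ^ 2) * Real.sqrt (pathEnergyTot ω t) := by
  rw [← integral_norm_sq_eq_pathEnergyTot hv hcoef]
  exact abs_integral_inner_le_sqrt_mul_sqrt hg hv

/-- A finite resolved enstrophy is at most the spectral enstrophy:
`ofReal (4π² ∑_{k∈T} |k|² ‖𝓕v(k)‖²) ≤ eGradNormSq v`. -/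
theorem ofReal_sum_freqNormSq_mul_norm_sq_le (T : Finset (d → ℤ))
    (v : UnitAddTorus d → EuclideanSpace ℝ d) :
    ENNReal.ofReal (4 * Real.pi ^ 2 * ∑ k ∈ T, freqNormSq k *
        ‖mFourierCoeff (EuclideanSpace.complexify ∘ v) k‖ ^ 2) ≤ eGradNormSq v := by
  rw [eGradNormSq_eq_tsum, ENNReal.ofReal_mul (by positivity),
    ENNReal.ofReal_sum_of_nonneg fun k _ => mul_nonneg (freqNormSq_nonneg k) (sq_nonneg _)]
  refine mul_le_mul_of_nonneg_left ?_ bot_le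
  calc ∑ k ∈ T, ENNReal.ofReal (freqNormSq k * ‖mFourierCoeff (EuclideanSpace.complexify ∘ v) k‖ ^ 2)
      = ∑ k ∈ T, ENNReal.ofReal (freqNormSq k) *
          ‖mFourierCoeff (EuclideanSpace.complexify ∘ v) k‖ₑ ^ 2 :=
        Finset.sum_congr rfl fun k _ => by
          rw [ENNReal.ofReal_mul (freqNormSq_nonneg k), enorm_sq_eq_ofReal_norm_sq]
    _ ≤ _ := ENNReal.sum_le_tsum T

/-- **Resolved dissipation of the path vs. enstrophy of the field**: if `𝓕 v = ω̄(t, ·)`,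
`‖∇v‖₂² < ∞` and `ν ≥ 0`, then `pathDiss ν K ω t ≤ ν ‖∇v‖₂²`. -/
theorem pathDiss_le_mul_toReal_eGradNormSq [DecidableEq d] {ν : ℝ} (hν : 0 ≤ ν) (K : ℕ) {ω : Path d} {t : ℝ}
    {v : UnitAddTorus d → EuclideanSpace ℝ d}
    (hcoef : ∀ k, mFourierCoeff (EuclideanSpace.complexify ∘ v) k = pathExt ω t k)
    (hfin : eGradNormSq v ≠ ⊤) :
    pathDiss ν K ω t ≤ ν * (eGradNormSq v).toReal := by
  unfold pathDiss
  refine mul_le_mul_of_nonneg_left ?_ hν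
  have h := ofReal_sum_freqNormSq_mul_norm_sq_le (freqBall K) v
  simp_rw [hcoef] at h
  have hnn : 0 ≤ 4 * Real.pi ^ 2 * ∑ k ∈ freqBall K, freqNormSq k * ‖pathExt ω t k‖ ^ 2 :=
    mul_nonneg (by positivity) (Finset.sum_nonneg fun k _ =>
      mul_nonneg (freqNormSq_nonneg k) (sq_nonneg _))
  exact (ENNReal.ofReal_le_iff_le_toReal hfin).1 h

/-! ### Measurability of the enstrophy along a path -/

/-- The spectral enstrophy series of a path is measurable in time. -/
theorem measurable_tsum_freqNormSq_pathExt {ω : Path d} (hω : ω ∈ pathSpace R L) (s : ℝ) :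
    Measurable fun t => ENNReal.ofReal (4 * Real.pi ^ 2) *
      ∑' k : d → ℤ, ENNReal.ofReal (freqNormSq k) * ‖pathExt ω (s + t) k‖ₑ ^ 2 := by
  refine Measurable.const_mul (Measurable.tsum fun k => Measurable.const_mul ?_ _) _
  exact (((continuous_pathExt_time hω k).comp (continuous_const.add continuous_id)).measurable
    ).enorm.pow_const 2

/-- **The enstrophy of the field of a path is measurable on `t > 0`.** -/
theorem aemeasurable_eGradNormSq_pathField {ω : Path d} (hω : ω ∈ pathSpace R L) {s : ℝ}
    {u : ℝ → UnitAddTorus d → EuclideanSpace ℝ d}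
    (hcoef : ∀ t, 0 ≤ t → ∀ k, mFourierCoeff (EuclideanSpace.complexify ∘ u t) k = pathExt ω (s + t) k)
    {S : Set ℝ} (hS : S ⊆ Ici 0) (hSm : MeasurableSet S) :
    AEMeasurable (fun t => eGradNormSq (u t)) (volume.restrict S) := by
  refine (measurable_tsum_freqNormSq_pathExt hω s).aemeasurable.congr ?_
  filter_upwards [ae_restrict_mem hSm] with t ht
  rw [eGradNormSq_eq_tsum]
  exact congr_arg _ (tsum_congr fun k => by rw [hcoef t (hS ht) k])

/-- The energy of the field of a path is `pathEnergyTot` along the (shifted) path, `t ≥ 0`. -/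
theorem integral_norm_sq_pathField {ω : Path d} {s : ℝ}
    {u : ℝ → UnitAddTorus d → EuclideanSpace ℝ d}
    (hu : ∀ t, 0 ≤ t → MemLp (u t) 2 volume ∧
      ∀ k, mFourierCoeff (EuclideanSpace.complexify ∘ u t) k = pathExt ω (s + t) k)
    {t : ℝ} (ht : 0 ≤ t) : ∫ x, ‖u t x‖ ^ 2 = pathEnergyTot ω (s + t) :=
  integral_norm_sq_eq_pathEnergyTot (hu t ht).1 (hu t ht).2

end Summit.AnomalousDissipation.AnomalousDissipation.Theorems.MomentParity
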